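import Literature.Analysis.FluidPDE.SereginZajaczkowski2007Lemma23Tools
import Literature.Analysis.FluidPDE.NecasRuzickaSverakEpsilon
import HarnessLib

/-!
# Seregin–Zajaczkowski 2007, Lemma 2.3 (`L6EpsilonRegularity`) proved from its printed inputs

Proofs-only companion of `SereginZajaczkowski2007.lean` (G. Seregin, W. Zajaczkowski, *A
sufficient condition of regularity for axially symmetric solutions to the Navier–Stokes
equations*, SIAM J. Math. Anal. 39 (2007) 669–685 = arXiv:math/0702720; numbers are those of the
arXiv version). No definitions. Main result:

`SereginZajaczkowski2007.l6EpsilonRegularity_of_inputs :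
  seregin_sverak_pressure_decay → lemarieRieusset_epsilon_regularity →
  (H2 : the gradient ε-regularity bound on the unit cylinder, a.e. form) → L6EpsilonRegularity`

(with `H2` the statement provided by `seregin2014_lemma61_gradient.ae_bound` of the facts file
`SereginEpsilonRegularityGradient.lean`; the three-facts corollary `l6EpsilonRegularity_of` is
recorded once that file is in the tree), i.e. the named fact `L6EpsilonRegularity` (Lemma 2.3: an `L₆` bound `∫_Q̂ |v|⁶ ≤ m` and
`𝒜_* = ∫_Q̂ |p|^{3/2}` for a suitable weak solution in `Q̂ = 𝒞(3/4, 9/4; 3/2) × ]-(3/2)², 0[` bound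
`|v| + |∇v| ≤ Φ₀(m, 𝒜_*)` on `𝒞(1,2;1) × ]-1,0[`) reduced to the three inputs of its printed proof
(arXiv p. 3):

> *Proof.* First, we remark `Q(z₀, 1/4) ⊂ Q̂` for any `z₀ ∈ 𝒞(1,2;1) × ]-1,0[`. It follows from
> (2.2), Hölder's inequality, and (2.6) that `D(z₀,r;p) ≤ c[(r/r₁) D(z₀,r₁;p) + (r₁/r)² m^{1/2}
> r₁^{1/2}]` (2.8) … take `r = τ^{k+1}/4` and `r₁ = τ^k/4` … choose `τ ∈ ]0,1[` so small to provide
> `cτ^{3/4} ≤ 1` … The latter inequality may be easily iterated … Given `ε > 0`, we can find an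
> integer number `k₀` so that `c[m^{1/2}τ^{(k₀+1)/2} + τ^{(k₀+1)/4}(𝒜_* + m^{1/2}τ⁻³(1-τ^{1/4})⁻¹)]
> ≤ ε`. But according to the so-called ε-regularity theory, see, for example, [LS], [ESS4], and
> [S8], the latter implies two bounds: `|v(z₀)| ≤ c/r₀` and `|∇v(z₀)| ≤ c/r₀²`, where
> `r₀ = τ^{k₀+1}/4`. Lemma 2.3 is proved.

The inputs, all accepted named facts of the tree:

* (2.2), "the decay estimate for pressure … The proof … is given in [S2]":
  `seregin_sverak_pressure_decay` (`PressureDecayEstimate.lean`; ball cylinders `Q_r(z₀) =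
  ]t₀ - r², t₀[ × B(x₀, r)`, for distributional solutions);
* "the ε-regularity theory", velocity half `|v(z₀)| ≤ c/r₀`:
  `lemarieRieusset_epsilon_regularity` (`CKNEpsilonRegularity.lean`, Lemarié-Rieusset 2016
  Thm. 14.4 = CKN Prop. 1), through its proved localisation to the accepted suitable class
  `epsilonRegularity_of_isSuitableWeakSolutionOn` (`NecasRuzickaSverakEpsilon.lean`);
* "the ε-regularity theory", gradient half `|∇v(z₀)| ≤ c/r₀²`: `seregin2014_lemma61_gradient`
  (`SereginEpsilonRegularityGradient.lean`, Seregin 2014 Ch. 6 Lemma 6.1 = [ESS4] Lemma 2.2,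
  case `k = 2`, on the unit cylinder), transported to `Q_ρ(z₀)` by the Navier–Stokes scaling.

The bookkeeping of the iteration is the one already set up for the twin reduction
`SereginSverak2009.unitScaleOffAxisBound_of_inputs` (`SereginSverakOffAxisEpsilon.lean`, which runs
the same printed proof, velocity half only, for the Type I pairs of Seregin–Šverák 2009):
`τ = σ²` with `cσ² ≤ 1/2` (`exists_ratio_sq`), the scales `s_k = σ^k/2` (`epsHalfScale`,
`r_k = s_k²`), the majorant `decayMajorant c σ a_m (16𝒜_*)` of `D(s_k²; z₀)` fed by the Hölder
bound `C(s²; z₀) ≤ a_m s`, `a_m = (|B₁| m)^{1/2}`, and the first index `epsIndex` at which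
`C + D ≤ η` (the `k₀` of the proof, minimal, hence monotone in `(m, 𝒜_*)`).

## Contents

The geometric and scaling tools (`Q(z₀,1/4) ⊂ Q̂` in ball form, the Hölder step, `D(1/4; z₀) ≤
16𝒜_*`, the rescaled pair `w(s, y) = ρ v(t₀ + ρ² s, x₀ + ρ y)`, `q = ρ² p ∘ Φ` in the class
`IsSuitableWeakSolutionInBall 1 0` of Seregin's Lemma 6.1, and the transported gradient bound
`ae_gradient_bound_of_lemma61`) are in `SereginZajaczkowski2007Lemma23Tools.lean`. Here:

* `cknC_cknD_le_at_scales` — the iteration: `C(s_k²; z₀) ≤ A s_k` and `D(s_k²; z₀) ≤ g_k` for all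
  `k`, at every admissible centre;
* `l6EpsilonRegularity_of_inputs` — the assembly: at the scale `ρ = s_{k₀}²`, `|v| ≤ C₀ε₁/ρ`
  (velocity criterion on `Q̂`, closed box `[t₀ - 1/16, t₀] × B̄(x₀, 1/4) ⊆ Q̂`) and `|∇v| ≤ c₀₂/ρ²`
  a.e. on `Q_{ρ/2}(z₀)`, so `Φ₀(m, 𝒜_*) = C₀ε₁/ρ + c₀₂/ρ²`; countably many such cylinders cover
  `𝒞(1,2;1) × ]-1,0[` (`ae_innerShell_of_centres`), which is how the pointwise "for any `z`" of the
  printed lemma is realised in the a.e. rendering of `L6EpsilonRegularity`. The gradient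
  ε-regularity input enters through the explicit hypothesis `H2` (the a.e. unit-cylinder form,
  which `seregin2014_lemma61_gradient.ae_bound` of `SereginEpsilonRegularityGradient.lean`
  provides), so that this file does not depend on that facts file.

## References

* G. Seregin, W. Zajaczkowski, SIAM J. Math. Anal. 39 (2007) 669–685, arXiv:math/0702720: §2,
  (2.2), Lemma 2.3 ((2.6)–(2.8)) and its proof (pp. 2–4). [`SereginZajaczkowski2007`]
* G. Seregin, *Lecture Notes on Regularity Theory for the Navier–Stokes Equations* (2014), Ch. 6,
  Lemma 6.1 (p. 90) and p. 100 ("Lemma 6.1 and the Navier–Stokes scaling"). [`Seregin2014`]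
* P. G. Lemarié-Rieusset, *The Navier–Stokes Problem in the 21st Century* (2016), Thm. 14.4.
  [`LemarieRieusset2016`]
* G. Seregin, V. Šverák, arXiv:0804.1803, proof of Prop. 3.7 (the twin reduction).
  [`SereginSverak2009`]
-/

noncomputable section

open MeasureTheory Set Function Filter Topology TopologicalSpace Module Metric
open scoped NNReal ENNReal

namespace Literature.Analysis.FluidPDE

namespace SereginZajaczkowski2007

open SereginSverak2009

/-! ### The iteration (2.8) along the scales `τ^k/4`, `τ = σ²` -/

section Iteration

variable {z₀ : ℝ × (EuclideanSpace ℝ (Fin 3))} {v : ℝ → (EuclideanSpace ℝ (Fin 3)) → (EuclideanSpace ℝ (Fin 3))} {p : ℝ → (EuclideanSpace ℝ (Fin 3)) → ℝ} {c σ m a A : ℝ≥0}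

/-- **The iteration of the proof of Lemma 2.3** ((2.8) along `r = τ^{k+1}/4`, `r₁ = τ^k/4`, "The
latter inequality may be easily iterated", arXiv p. 3), in the bookkeeping of the twin reduction
(`τ = σ²` with `cσ² ≤ 1/2`, scales `s_k² = τ^k/4`): given the decay estimate (2.2) with constant `c`
on the ball cylinders inside `Q̂` (hypothesis `h22`, the accepted `seregin_sverak_pressure_decay`
specialised to the pair), the `L₆` bound (2.6) `∫_Q̂ |v|⁶ ≤ m` and `∫_Q̂ |p|^{3/2} ≤ 𝒜_*`, for every
admissible centre and every `k`: `C(s_k²; z₀) ≤ A s_k` (`A = (|B₁| m)^{1/2}`, the Hölder step) and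
`D(s_k²; z₀) ≤ g_k`, `g = decayMajorant c σ A (16𝒜_*)` (`D(1/4; z₀) ≤ 16𝒜_*`, and between
consecutive scales `D(s_{k+1}²) ≤ ½ D(s_k²) + cσ⁻⁴ A s_k`, `decay_step_ennreal`).
[cite: SereginZajaczkowski2007, proof of Lemma 2.3 ((2.8) and its iteration, arXiv p. 3)] -/
theorem cknC_cknD_le_at_scales
    (h22 : ∀ (z : ℝ × (EuclideanSpace ℝ (Fin 3))) (r ϱ : ℝ), 0 < ϱ → ϱ ≤ r →
      parabolicCylinder r z ⊆ shellCyl (3 / 4) (9 / 4) (3 / 2) (3 / 2) →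
      cknD ϱ z p ≤ c * (ENNReal.ofReal (ϱ / r) * cknD r z p +
        ENNReal.ofReal ((r / ϱ) ^ 2) * cknC r z v))
    (hv : AEStronglyMeasurable (uncurry v)
      (volume.restrict (shellCyl (3 / 4) (9 / 4) (3 / 2) (3 / 2))))
    (h6 : ∫⁻ z in shellCyl (3 / 4) (9 / 4) (3 / 2) (3 / 2), ‖v z.1 z.2‖ₑ ^ (6 : ℕ) ≤ m)
    (ha : ∫⁻ z in shellCyl (3 / 4) (9 / 4) (3 / 2) (3 / 2), ‖p z.1 z.2‖ₑ ^ (3 / 2 : ℝ) ≤ a)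
    (h₀ : z₀ ∈ shellCyl 1 2 1 1) (hσ0 : 0 < σ) (hσ1 : σ < 1) (hcσ : c * σ ^ 2 ≤ 1 / 2)
    (hA : (A : ℝ≥0∞) = (volume (ball (0 : (EuclideanSpace ℝ (Fin 3))) 1) * m) ^ (2⁻¹ : ℝ)) (k : ℕ) :
    cknC (((epsHalfScale σ k : ℝ≥0) : ℝ) ^ 2) z₀ v ≤ ((A * epsHalfScale σ k : ℝ≥0) : ℝ≥0∞) ∧
      cknD (((epsHalfScale σ k : ℝ≥0) : ℝ) ^ 2) z₀ p ≤ (decayMajorant c σ A (16 * a) k : ℝ≥0∞) := by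
  have hσR : (0 : ℝ) < σ := by exact_mod_cast hσ0
  have hsk := epsHalfScale_pos_sq_le hσ0 hσ1
  -- the Hölder bound on `C` at the scales `s_k`
  have hCk : ∀ k, cknC (((epsHalfScale σ k : ℝ≥0) : ℝ) ^ 2) z₀ v ≤
      ((A * epsHalfScale σ k : ℝ≥0) : ℝ≥0∞) := by
    intro k
    have := cknC_le_of_sixth_bound_hat hv h6 h₀ (hsk k).1 (hsk k).2
    rwa [ENNReal.ofReal_coe_nnreal, ← hA, ← ENNReal.coe_mul] at this
  refine ⟨hCk k, ?_⟩
  -- the decay estimate between consecutive scales, inside `Q̂`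
  have h22z : ∀ k, cknD ((σ * (epsHalfScale σ k : ℝ)) ^ 2) z₀ p ≤
      c * (ENNReal.ofReal ((σ * (epsHalfScale σ k : ℝ)) ^ 2 / (epsHalfScale σ k : ℝ) ^ 2) *
        cknD ((epsHalfScale σ k : ℝ) ^ 2) z₀ p +
        ENNReal.ofReal (((epsHalfScale σ k : ℝ) ^ 2 / (σ * (epsHalfScale σ k : ℝ)) ^ 2) ^ 2) *
        cknC ((epsHalfScale σ k : ℝ) ^ 2) z₀ v) := by
    intro k
    obtain ⟨hs0, hs4⟩ := hsk k
    have hσ1R : (σ : ℝ) ≤ 1 := by exact_mod_cast hσ1.le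
    have hle : ((σ : ℝ) * (epsHalfScale σ k : ℝ)) ^ 2 ≤ (epsHalfScale σ k : ℝ) ^ 2 :=
      pow_le_pow_left₀ (by positivity) (mul_le_of_le_one_left hs0.le hσ1R) 2
    exact h22 z₀ _ _ (by positivity) hle (parabolicCylinder_subset_shellCyl_hat h₀ hs4)
  -- `D(s_k²; z₀) ≤ g_k`
  induction k with
  | zero =>
    have e0 : ((epsHalfScale σ 0 : ℝ≥0) : ℝ) ^ 2 = 1 / 4 := by
      simp [epsHalfScale]
      norm_num
    rw [e0]
    exact cknD_quarter_le_of_hat h₀ ha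
  | succ k ih =>
    obtain ⟨hs0, hs4⟩ := hsk k
    set s : ℝ := ((epsHalfScale σ k : ℝ≥0) : ℝ) with hs
    have e1 : ((epsHalfScale σ (k + 1) : ℝ≥0) : ℝ) = σ * s := by
      simp [hs, epsHalfScale, pow_succ]
      ring
    have h := h22z k
    obtain ⟨e2, e3⟩ := scale_ratios hσR hs0
    rw [e2, e3, show ENNReal.ofReal ((σ : ℝ) ^ 2) = ((σ ^ 2 : ℝ≥0) : ℝ≥0∞) by
        rw [← NNReal.coe_pow, ENNReal.ofReal_coe_nnreal],
      show ENNReal.ofReal (((σ : ℝ) ^ 4)⁻¹) = (((σ ^ 4)⁻¹ : ℝ≥0) : ℝ≥0∞) by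
        rw [← NNReal.coe_pow, ← NNReal.coe_inv, ENNReal.ofReal_coe_nnreal]] at h
    rw [e1, decayMajorant_succ]
    exact decay_step_ennreal hcσ h ih (hCk k)

end Iteration

/-! ### Lemma 2.3 from its inputs -/

/-- **Seregin–Zajaczkowski 2007, Lemma 2.3 (`L6EpsilonRegularity`) from the inputs of its printed
proof**: the decay estimate for the pressure (2.2) (`seregin_sverak_pressure_decay`), the velocity
ε-regularity criterion (`lemarieRieusset_epsilon_regularity`, through the proved
`epsilonRegularity_of_isSuitableWeakSolutionOn`), and the gradient ε-regularity bound in the a.e.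
unit-cylinder form `H2` (constants `ε₂, c₀₂`; supplied by `seregin2014_lemma61_gradient.ae_bound`).
Proof as printed (arXiv p. 3), in the a.e. rendering: fix `τ = σ²` with `cσ² ≤ 1/2`; for data
`(m, 𝒜_*)` put `A = (|B₁| m)^{1/2}`, `η = min(ε₁³, ε₂/2)` and let `k₀ = k₀(m, 𝒜_*)` be the first
index with `g_{k₀} + A s_{k₀} ≤ η` (`epsIndex`; `g = decayMajorant c σ A (16𝒜_*)`), `ρ = s_{k₀}²`.
For a suitable weak solution in `Q̂` with the classes of Def. 1.1, `∫_Q̂ |v|⁶ ≤ m`,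
`∫_Q̂ |p|^{3/2} ≤ 𝒜_*`, and a centre `z₀ ∈ 𝒞(1,2;1) × ]-1,0[`, the iteration
(`cknC_cknD_le_at_scales`) gives `C(ρ; z₀) + D(ρ; z₀) ≤ η`, i.e.
`∫_{Q_ρ(z₀)} (|v|³ + |p|^{3/2}) ≤ η ρ²`; the velocity criterion on `Q̂` (closed box
`[t₀ - 1/16, t₀] × B̄(x₀, 1/4) ⊆ Q̂`) bounds `|v| ≤ C₀ε₁/ρ` a.e. on `Q_{ρ/2}(z₀)`, and the gradient
bound transported by the scaling (`ae_gradient_bound_of_lemma61`) gives `|∇v| ≤ c₀₂/ρ²` a.e. there.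
Countably many cylinders `Q_{ρ/2}(z₀)` cover `𝒞(1,2;1) × ]-1,0[` (`ae_innerShell_of_centres`).
`Φ₀(m, 𝒜_*) = C₀ε₁/ρ + c₀₂/ρ²` is non-decreasing in each variable because `k₀` is.
[cite: SereginZajaczkowski2007, Lemma 2.3 and its proof (arXiv pp. 3–4)] -/
theorem l6EpsilonRegularity_of_inputs (h22 : seregin_sverak_pressure_decay)
    (hLR : lemarieRieusset_epsilon_regularity) {ε₂ c₀₂ : ℝ} (hε₂ : 0 < ε₂) (hc₀₂ : 0 < c₀₂)
    (H2 : ∀ (U : ℝ → (EuclideanSpace ℝ (Fin 3)) → (EuclideanSpace ℝ (Fin 3))) (P : ℝ → (EuclideanSpace ℝ (Fin 3)) → ℝ) (G : ℝ → (EuclideanSpace ℝ (Fin 3)) → (EuclideanSpace ℝ (Fin 3)) →L[ℝ] (EuclideanSpace ℝ (Fin 3))),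
      IsSuitableWeakSolutionInBall 1 ((0 : ℝ), (0 : (EuclideanSpace ℝ (Fin 3)))) U P →
      HasWeakSpatialGradientOn (parabolicCylinderOpens 1 ((0 : ℝ), (0 : (EuclideanSpace ℝ (Fin 3))))) U G →
      ∫⁻ z in parabolicCylinder 1 ((0 : ℝ), (0 : (EuclideanSpace ℝ (Fin 3)))),
          (‖U z.1 z.2‖ₑ ^ (3 : ℕ) + ‖P z.1 z.2‖ₑ ^ (3 / 2 : ℝ)) < ENNReal.ofReal ε₂ →
      ∀ᵐ z ∂(volume.restrict (parabolicCylinder (1 / 2) ((0 : ℝ), (0 : (EuclideanSpace ℝ (Fin 3)))))),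
        Real.sqrt (frobeniusNormSq (G z.1 z.2)) < c₀₂) :
    L6EpsilonRegularity := by
  obtain ⟨c, h22⟩ := h22
  obtain ⟨ε₁, C₀, hε₁, hC₀, H1⟩ := epsilonRegularity_of_isSuitableWeakSolutionOn hLR one_pos
  obtain ⟨σ, hσ0, hσ1, hcσ⟩ := exists_ratio_sq c
  -- the constants: `B = |B₁|`, `A_m = (B m)^{1/2}`, `η = min (ε₁³, ε₂/2)`
  set B : ℝ≥0∞ := volume (ball (0 : (EuclideanSpace ℝ (Fin 3))) 1) with hB
  have hBfin : B < ∞ := measure_ball_lt_top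
  have hafin : ∀ m : ℝ≥0, (B * (m : ℝ≥0∞)) ^ (2⁻¹ : ℝ) ≠ ∞ := fun m =>
    ENNReal.rpow_ne_top_of_nonneg (by norm_num) (ENNReal.mul_ne_top hBfin.ne ENNReal.coe_ne_top)
  set aa : ℝ≥0 → ℝ≥0 := fun m => ((B * (m : ℝ≥0∞)) ^ (2⁻¹ : ℝ)).toNNReal with haa
  have haacoe : ∀ m, (aa m : ℝ≥0∞) = (B * (m : ℝ≥0∞)) ^ (2⁻¹ : ℝ) := fun m =>
    ENNReal.coe_toNNReal (hafin m)
  have haamono : Monotone aa := fun m m' h =>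
    ENNReal.toNNReal_mono (hafin m')
      (ENNReal.rpow_le_rpow (mul_le_mul' le_rfl (ENNReal.coe_le_coe.2 h)) (by norm_num))
  have hηpos' : 0 < min (ε₁ ^ 3) (ε₂ / 2) := lt_min (by positivity) (by positivity)
  set η : ℝ≥0 := Real.toNNReal (min (ε₁ ^ 3) (ε₂ / 2)) with hη
  have hη0 : 0 < η := Real.toNNReal_pos.2 hηpos'
  have hηcoe : (η : ℝ≥0∞) = ENNReal.ofReal (min (ε₁ ^ 3) (ε₂ / 2)) := rfl
  -- the scale `ρ(m, 𝒜_*) = s_{k₀}²` and the function `Φ₀`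
  set ρ : ℝ≥0 → ℝ≥0 → ℝ := fun m a =>
    ((epsHalfScale σ (epsIndex c σ η (aa m) (16 * a)) : ℝ≥0) : ℝ) ^ 2 with hρ
  have hρpos : ∀ m a, 0 < ρ m a := fun m a => by
    have := (epsHalfScale_pos_sq_le hσ0 hσ1 (epsIndex c σ η (aa m) (16 * a))).1
    positivity
  have hρ4 : ∀ m a, ρ m a ≤ 1 / 4 := fun m a =>
    (epsHalfScale_pos_sq_le hσ0 hσ1 (epsIndex c σ η (aa m) (16 * a))).2
  have hρanti : ∀ m m' a a', m ≤ m' → a ≤ a' → ρ m' a' ≤ ρ m a := by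
    intro m m' a a' hm ha
    have hk : epsIndex c σ η (aa m) (16 * a) ≤ epsIndex c σ η (aa m') (16 * a') :=
      epsIndex_mono c η hσ1 hη0 (haamono hm) (mul_le_mul' le_rfl ha)
    have hs := epsHalfScale_antitone hσ1.le hk
    exact pow_le_pow_left₀ (NNReal.coe_nonneg _) (NNReal.coe_le_coe.2 hs) 2
  set Φ₀ : ℝ≥0 → ℝ≥0 → ℝ≥0 := fun m a =>
    ⟨C₀ * ε₁ / ρ m a + c₀₂ / ρ m a ^ 2, by have := hρpos m a; positivity⟩ with hΦ₀
  have hΦ₀mono : ∀ m m' a a', m ≤ m' → a ≤ a' → Φ₀ m a ≤ Φ₀ m' a' := by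
    intro m m' a a' hm ha
    have h1 := hρanti m m' a a' hm ha
    have h2 := hρpos m' a'
    rw [← NNReal.coe_le_coe]
    show C₀ * ε₁ / ρ m a + c₀₂ / ρ m a ^ 2 ≤ C₀ * ε₁ / ρ m' a' + c₀₂ / ρ m' a' ^ 2
    exact add_le_add (div_le_div_of_nonneg_left (by positivity) h2 h1)
      (div_le_div_of_nonneg_left hc₀₂.le (pow_pos h2 2) (pow_le_pow_left₀ h2.le h1 2))
  refine ⟨Φ₀, fun m a a' h => hΦ₀mono m m a a' le_rfl h,
    fun a m m' h => hΦ₀mono m m' a a h le_rfl, ?_⟩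
  intro v p G hsws hG hA hE m a hm ha
  have hP : ∫⁻ z in shellCyl (3 / 4) (9 / 4) (3 / 2) (3 / 2), ‖p z.1 z.2‖ₑ ^ (3 / 2 : ℝ) < ⊤ :=
    ha.trans_lt ENNReal.coe_lt_top
  have hdist := hsws.distributional
  have hvmeas : AEStronglyMeasurable (uncurry v)
      (volume.restrict (shellCyl (3 / 4) (9 / 4) (3 / 2) (3 / 2))) :=
    hdist.1.aestronglyMeasurable
  have h22Q : ∀ (z : ℝ × (EuclideanSpace ℝ (Fin 3))) (r ϱ : ℝ), 0 < ϱ → ϱ ≤ r →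
      parabolicCylinder r z ⊆ shellCyl (3 / 4) (9 / 4) (3 / 2) (3 / 2) →
      cknD ϱ z p ≤ c * (ENNReal.ofReal (ϱ / r) * cknD r z p +
        ENNReal.ofReal ((r / ϱ) ^ 2) * cknC r z v) :=
    fun z r ϱ h1 h2 h3 => h22 _ v p hdist z r ϱ h1 h2 h3
  set k₀ : ℕ := epsIndex c σ η (aa m) (16 * a) with hk₀
  -- the bound on every cylinder `Q_{ρ/2}(z₀)`
  have hcentre : ∀ z₀ ∈ shellCyl 1 2 1 1,
      ∀ᵐ w ∂(volume.restrict (parabolicCylinder (ρ m a / 2) z₀)),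
        ‖v w.1 w.2‖ + Real.sqrt (frobeniusNormSq (G w.1 w.2)) ≤ ((Φ₀ m a : ℝ≥0) : ℝ) := by
    intro z₀ h₀
    have hk := fun k => cknC_cknD_le_at_scales h22Q hvmeas hm ha h₀ hσ0 hσ1 hcσ (haacoe m) k
    -- smallness at the scale `ρ = s_{k₀}²`
    have hspec := epsIndex_spec c (aa m) (16 * a) hσ1 hη0
    have hCD : cknC (ρ m a) z₀ v + cknD (ρ m a) z₀ p ≤ η :=
      calc cknC (ρ m a) z₀ v + cknD (ρ m a) z₀ p
          ≤ ((aa m * epsHalfScale σ k₀ : ℝ≥0) : ℝ≥0∞) +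
              (decayMajorant c σ (aa m) (16 * a) k₀ : ℝ≥0∞) :=
            add_le_add (hk k₀).1 (hk k₀).2
        _ ≤ η := by rw [add_comm]; exact_mod_cast hspec
    have hvmeasρ : AEMeasurable (fun z : ℝ × (EuclideanSpace ℝ (Fin 3)) => ‖v z.1 z.2‖ₑ ^ (3 : ℕ))
        (volume.restrict (parabolicCylinder (ρ m a) z₀)) :=
      ((hvmeas.mono_measure (Measure.restrict_mono
        (parabolicCylinder_subset_shellCyl_hat h₀ (hρ4 m a)) le_rfl)).enorm.pow_const _)
    have hint : ∫⁻ w in parabolicCylinder (ρ m a) z₀,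
        (‖v w.1 w.2‖ₑ ^ (3 : ℕ) + ‖p w.1 w.2‖ₑ ^ (3 / 2 : ℝ)) =
          ENNReal.ofReal (ρ m a) ^ 2 * (cknC (ρ m a) z₀ v + cknD (ρ m a) z₀ p) := by
      rw [lintegral_add_left' hvmeasρ, setLIntegral_eq_mul_cknC z₀ (hρpos m a),
        setLIntegral_eq_mul_cknD z₀ (hρpos m a), mul_add]
    -- the velocity half: `|v| ≤ C₀ε₁/ρ` a.e. on `Q_{ρ/2}(z₀)`
    have hsmall1 : ∫⁻ w in parabolicCylinder (ρ m a) z₀,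
        (‖v w.1 w.2‖ₑ ^ (3 : ℕ) + ‖p w.1 w.2‖ₑ ^ (3 / 2 : ℝ)) ≤
          ENNReal.ofReal (ε₁ ^ 3 * ρ m a ^ 2) := by
      rw [hint]
      calc ENNReal.ofReal (ρ m a) ^ 2 * (cknC (ρ m a) z₀ v + cknD (ρ m a) z₀ p)
          ≤ ENNReal.ofReal (ρ m a) ^ 2 * η := mul_le_mul' le_rfl hCD
        _ ≤ ENNReal.ofReal (ρ m a) ^ 2 * ENNReal.ofReal (ε₁ ^ 3) := by
            rw [hηcoe]
            exact mul_le_mul' le_rfl (ENNReal.ofReal_le_ofReal (min_le_left _ _))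
        _ = ENNReal.ofReal (ε₁ ^ 3 * ρ m a ^ 2) := by
            rw [← ENNReal.ofReal_pow (hρpos m a).le, ← ENNReal.ofReal_mul (by positivity),
              mul_comm]
    have hbox : Icc (z₀.1 - (1 / 4 : ℝ) ^ 2) z₀.1 ×ˢ closedBall z₀.2 (1 / 4) ⊆
        ((shellCylOpens (3 / 4) (9 / 4) (3 / 2) (3 / 2) : Opens (ℝ × (EuclideanSpace ℝ (Fin 3)))) : Set (ℝ × (EuclideanSpace ℝ (Fin 3)))) :=
      closedBox_subset_shellCyl_hat h₀ le_rfl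
    have hv1 := H1 _ v p hsws z₀ (ρ m a) (1 / 4) (hρpos m a) (hρ4 m a) hbox hsmall1
    -- the gradient half: `|∇v| ≤ c₀₂/ρ²` a.e. on `Q_{ρ/2}(z₀)`
    have hsmall2 : (ENNReal.ofReal (ρ m a) ^ 2)⁻¹ * ∫⁻ w in parabolicCylinder (ρ m a) z₀,
        (‖v w.1 w.2‖ₑ ^ (3 : ℕ) + ‖p w.1 w.2‖ₑ ^ (3 / 2 : ℝ)) < ENNReal.ofReal ε₂ := by
      rw [hint, ← mul_assoc, ENNReal.inv_mul_cancel (by simp [(hρpos m a)]) (by simp), one_mul]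
      refine hCD.trans_lt ?_
      rw [hηcoe, ENNReal.ofReal_lt_ofReal_iff hε₂]
      exact (min_le_right _ _).trans_lt (by linarith)
    have hg1 := ae_gradient_bound_of_lemma61 H2 hsws hG hA hE hP h₀ (hρpos m a) (hρ4 m a) hsmall2
    filter_upwards [hv1, hg1] with w hw1 hw2
    exact add_le_add hw1 hw2
  have key := ae_innerShell_of_centres
    (P := fun w => ‖v w.1 w.2‖ + Real.sqrt (frobeniusNormSq (G w.1 w.2)) ≤ ((Φ₀ m a : ℝ≥0) : ℝ))
    (hρpos m a) hcentre
  rwa [innerShell_one_eq] at key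

end SereginZajaczkowski2007

end Literature.Analysis.FluidPDE
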